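import Literature.MathematicalPhysics.QuantumFieldTheory.ConstructiveQFTWave0
import Literature.MathematicalPhysics.QuantumLattice.MagneticHubbardTorusTrivialField

/-!
# Strong-coupling floor engine, part 4: lattice geometry of the unit cube between two facing plaquettes

Pooled prover `ym-ir-line-bsf-p1` (crux `IR`, stmt-QuantumFields-19354; director-ym R366 pooled queue), support file for
`FacingPlaquetteCovFloor`.  Pure combinatorics of the 4-torus `(ℤ/L)⁴`, `L ≥ 3`: the observed plaquettes are
`P₀ = (0; 1,2)` and its time translate `P₁ = (e₀; 1,2)`; the four LATERAL plaquettes `(0; 0,1)`, `(e₂; 0,1)`,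
`(0; 0,2)`, `(e₁; 0,2)` are the side faces of the unit cube joining them.

* `bond_unique_of_ne` — a plaquette other than `P = (x; 1,2)` contains AT MOST ONE bond of `P`;
* `lateral_of_shares_both` — a plaquette containing a bond of `P₀` and a bond of `P₁` is one of the four laterals;
* `eq_laterals_of_covering` — if `|Q| ≤ 4`, every bond of `P₀` lies in a member of `Q` other than `P₀` and every bond
  of `P₁` in a member of `Q` other than `P₁`, then `Q` is exactly the set of the four laterals (the only short Mayer
  polymers surviving antisymmetric-pair peeling, part 3);
* `cubeEdge_injective` — the twelve bonds of the cube are distinct (input for the cube integral, part 2).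
Bond sets are literal finsets; no definitions.  Nothing here bears on the Yang–Mills mass gap.
-/

set_option autoImplicit false

open Function
open Literature.MathematicalPhysics.QuantumFieldTheory

namespace Summit.QuantumFields.YangMills.Cruxes.IR.SCFloor

variable {L : ℕ}

/-! ## §1 Coordinates on the 4-torus -/
/-- Coordinates of a shifted site. -/
theorem shift_apply (x : Site 4 L) (a k : Fin 4) :
    x.shift a k = x k + if k = a then 1 else 0 := by
  simp only [Site.shift, Pi.add_apply, Pi.single_apply]

/-- Bonds of the plaquette `(x; 1, 2)`: coordinates `0` and `3` are those of `x`, the direction is `1` or `2`, and the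
base point is `x` or `x + e₂` (direction `1`), resp. `x + e₁` or `x` (direction `2`). -/
theorem bondP_cases (x : Site 4 L) {e : Edge 4 L}
    (he : e ∈ ({(x, (1 : Fin 4)), (x.shift 1, (2 : Fin 4)), (x.shift 2, (1 : Fin 4)), (x, (2 : Fin 4))} :
      Finset (Edge 4 L))) :
    e.1 0 = x 0 ∧ e.1 3 = x 3 ∧
      ((e.2 = 1 ∧ (e.1 = x ∨ e.1 = x.shift 2)) ∨ (e.2 = 2 ∧ (e.1 = x.shift 1 ∨ e.1 = x))) := by
  simp only [Finset.mem_insert, Finset.mem_singleton] at he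
  rcases he with rfl | rfl | rfl | rfl <;> simp [shift_apply]

/-- Bonds of a general plaquette `(y; i, j)`: direction `i` with base `y` or `y + eⱼ`, or direction `j` with base
`y + eᵢ` or `y`. -/
theorem bondQ_cases (y : Site 4 L) (i j : Fin 4) {e : Edge 4 L}
    (he : e ∈ ({(y, i), (y.shift i, j), (y.shift j, i), (y, j)} : Finset (Edge 4 L))) :
    (e.2 = i ∧ (e.1 = y ∨ e.1 = y.shift j)) ∨ (e.2 = j ∧ (e.1 = y.shift i ∨ e.1 = y)) := by
  simp only [Finset.mem_insert, Finset.mem_singleton] at he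
  rcases he with rfl | rfl | rfl | rfl <;> simp

/-! ## §2 A plaquette other than `P = (x; 1,2)` contains at most one bond of `P` -/

-- lint justification: one uniform closing simp set (`h1`, `h2`) serves sixteen symmetric cases, each using one fact.
set_option linter.unusedSimpArgs false in
/-- **At most one shared bond.**  Let `P = (x; 1, 2)` and `q = (y; i, j)` with `i < j` and `q ≠ P`.  If two bonds
`e, e'` of `P` are both bonds of `q`, then `e = e'`.  (`L ≥ 3`.) -/
theorem bond_unique_of_ne (hL : 3 ≤ L) (x y : Site 4 L) {i j : Fin 4} (hij : i < j)
    (hq : ¬ (y = x ∧ i = 1 ∧ j = 2)) {e e' : Edge 4 L}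
    (he : e ∈ ({(x, (1 : Fin 4)), (x.shift 1, (2 : Fin 4)), (x.shift 2, (1 : Fin 4)), (x, (2 : Fin 4))} :
      Finset (Edge 4 L)))
    (heq : e ∈ ({(y, i), (y.shift i, j), (y.shift j, i), (y, j)} : Finset (Edge 4 L)))
    (he' : e' ∈ ({(x, (1 : Fin 4)), (x.shift 1, (2 : Fin 4)), (x.shift 2, (1 : Fin 4)), (x, (2 : Fin 4))} :
      Finset (Edge 4 L)))
    (he'q : e' ∈ ({(y, i), (y.shift i, j), (y.shift j, i), (y, j)} : Finset (Edge 4 L))) : e = e' := by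
  have h1 : (1 : ZMod L) ≠ 0 := by haveI : Fact (1 < L) := ⟨by omega⟩; exact one_ne_zero
  have h2 := Literature.MathematicalPhysics.QuantumLattice.zmod_one_add_one_ne_zero_of_three_le hL
  obtain ⟨e0, e3, hP⟩ := bondP_cases x he; obtain ⟨e0', e3', hP'⟩ := bondP_cases x he'
  have hQ := bondQ_cases y i j heq; have hQ' := bondQ_cases y i j he'q
  by_contra hne
  -- directions of shared bonds are `1` or `2`
  have hdir : e.2 = 1 ∨ e.2 = 2 := by rcases hP with h | h <;> simp [h.1]
  have hdir' : e'.2 = 1 ∨ e'.2 = 2 := by rcases hP' with h | h <;> simp [h.1]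
  by_cases hi0 : i = 0
  · -- timelike plaquette: its direction-`j` bonds sit at times `y 0` and `y 0 + 1`
    subst hi0
    have hA : ∀ {f : Edge 4 L}, (f.2 = 1 ∨ f.2 = 2) → f.1 0 = x 0 →
        ((f.2 = 0 ∧ (f.1 = y ∨ f.1 = y.shift j)) ∨ (f.2 = j ∧ (f.1 = y.shift 0 ∨ f.1 = y))) →
        f.2 = j ∧ (f.1 = y.shift 0 ∨ f.1 = y) := by
      intro f hf _ hfQ
      rcases hfQ with h | h
      · rcases hf with hf | hf <;> simp [hf] at h
      · exact h
    obtain ⟨hd, hs⟩ := hA hdir e0 hQ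
    obtain ⟨hd', hs'⟩ := hA hdir' e0' hQ'
    have hsite : e.1 ≠ e'.1 := fun h => hne (Prod.ext h (hd.trans hd'.symm))
    rcases hs with hs | hs <;> rcases hs' with hs' | hs' <;> rw [hs] at e0 <;> rw [hs'] at e0'
    exacts [hsite (hs.trans hs'.symm), by rw [← e0'] at e0; simp [shift_apply, h1] at e0,
      by rw [← e0] at e0'; simp [shift_apply, h1] at e0', hsite (hs.trans hs'.symm)]
  by_cases hj3 : j = 3
  · -- spatial plaquette in a plane containing direction `3`: its direction-`i` bonds sit at `y 3`, `y 3 + 1`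
    subst hj3
    have hA : ∀ {f : Edge 4 L}, (f.2 = 1 ∨ f.2 = 2) →
        ((f.2 = i ∧ (f.1 = y ∨ f.1 = y.shift 3)) ∨ (f.2 = 3 ∧ (f.1 = y.shift i ∨ f.1 = y))) →
        f.2 = i ∧ (f.1 = y ∨ f.1 = y.shift 3) := by
      intro f hf hfQ
      rcases hfQ with h | h
      · exact h
      · rcases hf with hf | hf <;> simp [hf] at h
    obtain ⟨hd, hs⟩ := hA hdir hQ
    obtain ⟨hd', hs'⟩ := hA hdir' hQ'
    have hsite : e.1 ≠ e'.1 := fun h => hne (Prod.ext h (hd.trans hd'.symm))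
    rcases hs with hs | hs <;> rcases hs' with hs' | hs' <;> rw [hs] at e3 <;> rw [hs'] at e3'
    exacts [hsite (hs.trans hs'.symm), by rw [← e3] at e3'; simp [shift_apply, h1] at e3',
      by rw [← e3'] at e3; simp [shift_apply, h1] at e3, hsite (hs.trans hs'.symm)]
  -- the plane `(1, 2)` itself
  have hd1 : e.2 = i ∨ e.2 = j := by rcases hQ with h | h <;> simp [h.1]
  have hi : i = 1 := by omega
  have hj : j = 2 := by omega
  subst hi; subst hj
  have hyx : y ≠ x := fun h => hq ⟨h, rfl, rfl⟩
  -- from the coordinates `1, 2` of the shared bonds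
  have c1 : ∀ {f : Edge 4 L},
      ((f.2 = 1 ∧ (f.1 = x ∨ f.1 = x.shift 2)) ∨ (f.2 = 2 ∧ (f.1 = x.shift 1 ∨ f.1 = x))) →
      ((f.2 = 1 ∧ (f.1 = y ∨ f.1 = y.shift 2)) ∨ (f.2 = 2 ∧ (f.1 = y.shift 1 ∨ f.1 = y))) →
      (f.2 = 1 ∧ (y = x.shift 2 ∨ y.shift 2 = x) ∨ f.2 = 2 ∧ (y.shift 1 = x ∨ y = x.shift 1)) := by
    intro f hfP hfQ
    rcases hfP with ⟨hd, hs⟩ | ⟨hd, hs⟩ <;> rcases hfQ with ⟨hd', hs'⟩ | ⟨hd', hs'⟩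
    · left; refine ⟨hd, ?_⟩
      rcases hs with hs | hs <;> rcases hs' with hs' | hs'
      exacts [absurd (hs'.symm.trans hs) hyx, Or.inr (by rw [← hs', hs]), Or.inl (by rw [← hs', hs]),
        (hyx (by simpa [Site.shift] using hs'.symm.trans hs)).elim]
    · exfalso; rw [hd] at hd'; exact absurd hd' (by decide)
    · exfalso; rw [hd] at hd'; exact absurd hd' (by decide)
    · right; refine ⟨hd, ?_⟩
      rcases hs with hs | hs <;> rcases hs' with hs' | hs'
      exacts [(hyx (by simpa [Site.shift] using hs'.symm.trans hs)).elim, Or.inr (by rw [← hs', hs]),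
        Or.inl (by rw [← hs', hs]), absurd (hs'.symm.trans hs) hyx]
  have k1 := c1 hP hQ
  have k2 := c1 hP' hQ'
  -- same direction ⇒ the two shared bonds have different base points
  have hsame : e.2 = e'.2 → e.1 ≠ e'.1 := fun hd h => hne (Prod.ext h hd)
  -- each of the four relations pins `y − x`; any two of them are incompatible (`L ≥ 3`), except equal ones,
  -- which force the two shared bonds to coincide
  have r1 : ∀ {f : Edge 4 L}, f.2 = 1 →
      ((f.2 = 1 ∧ (f.1 = x ∨ f.1 = x.shift 2)) ∨ (f.2 = 2 ∧ (f.1 = x.shift 1 ∨ f.1 = x))) →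
      ((f.2 = 1 ∧ (f.1 = y ∨ f.1 = y.shift 2)) ∨ (f.2 = 2 ∧ (f.1 = y.shift 1 ∨ f.1 = y))) →
      (y = x.shift 2 → f.1 = y) ∧ (y.shift 2 = x → f.1 = x) := by
    intro f hd hfP hfQ
    rcases hfP with ⟨-, hs⟩ | ⟨hd', -⟩
    · rcases hfQ with ⟨-, hs'⟩ | ⟨hd', -⟩
      · constructor
        · intro hy
          rcases hs' with hs' | hs'
          · exact hs'
          · exfalso; rcases hs with hs | hs <;>
              (have := congrFun (hs'.symm.trans hs) 2; rw [hy] at this; simp [shift_apply, add_assoc, h1, h2] at this)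
        · intro hy
          rcases hs with hs | hs
          · exact hs
          · exfalso; rcases hs' with hs' | hs' <;>
              (have := congrFun (hs'.symm.trans hs) 2; rw [← hy] at this; simp [shift_apply, add_assoc, h1, h2] at this)
      · rw [hd] at hd'; exact absurd hd' (by decide)
    · rw [hd] at hd'; exact absurd hd' (by decide)
  have r2 : ∀ {f : Edge 4 L}, f.2 = 2 →
      ((f.2 = 1 ∧ (f.1 = x ∨ f.1 = x.shift 2)) ∨ (f.2 = 2 ∧ (f.1 = x.shift 1 ∨ f.1 = x))) →
      ((f.2 = 1 ∧ (f.1 = y ∨ f.1 = y.shift 2)) ∨ (f.2 = 2 ∧ (f.1 = y.shift 1 ∨ f.1 = y))) →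
      (y.shift 1 = x → f.1 = x) ∧ (y = x.shift 1 → f.1 = y) := by
    intro f hd hfP hfQ
    rcases hfP with ⟨hd', -⟩ | ⟨-, hs⟩
    · rw [hd] at hd'; exact absurd hd' (by decide)
    · rcases hfQ with ⟨hd', -⟩ | ⟨-, hs'⟩
      · rw [hd] at hd'; exact absurd hd' (by decide)
      · constructor
        · intro hy
          rcases hs with hs | hs
          · exfalso; rcases hs' with hs' | hs' <;>
              (have := congrFun (hs'.symm.trans hs) 1; rw [← hy] at this; simp [shift_apply, add_assoc, h1, h2] at this)
          · exact hs
        · intro hy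
          rcases hs' with hs' | hs'
          · exfalso; rcases hs with hs | hs <;>
              (have := congrFun (hs'.symm.trans hs) 1; rw [hy] at this; simp [shift_apply, add_assoc, h1, h2] at this)
          · exact hs'
  rcases k1 with ⟨d1, s1⟩ | ⟨d1, s1⟩ <;> rcases k2 with ⟨d2, s2⟩ | ⟨d2, s2⟩
  · -- both direction 1
    have hb := hsame (d1.trans d2.symm)
    rcases s1 with s1 | s1 <;> rcases s2 with s2 | s2
    · exact hb (((r1 d1 hP hQ).1 s1).trans ((r1 d2 hP' hQ').1 s2).symm)
    · have := congrFun s2 2; rw [s1] at this; simp [shift_apply, add_assoc, h1, h2] at this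
    · have := congrFun s1 2; rw [s2] at this; simp [shift_apply, add_assoc, h1, h2] at this
    · exact hb (((r1 d1 hP hQ).2 s1).trans ((r1 d2 hP' hQ').2 s2).symm)
  · -- directions 1 and 2
    rcases s1 with s1 | s1 <;> rcases s2 with s2 | s2
    · have := congrFun s2 1; rw [s1] at this; simp [shift_apply, add_assoc, h1, h2] at this
    · have := congrFun s2 2; rw [s1] at this  -- wait: s2 : y = x.shift 1; s1 : y = x.shift 2
      simp [shift_apply, add_assoc, h1, h2] at this
    · have := congrFun s2 2; rw [← s1] at this; simp [shift_apply, add_assoc, h1, h2] at this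
    · have := congrFun s1 1; rw [s2] at this; simp [shift_apply, add_assoc, h1, h2] at this
  · rcases s1 with s1 | s1 <;> rcases s2 with s2 | s2
    · have := congrFun s1 1; rw [s2] at this; simp [shift_apply, add_assoc, h1, h2] at this
    · have := congrFun s1 2; rw [← s2] at this; simp [shift_apply, add_assoc, h1, h2] at this
    · have := congrFun s1 2; rw [s2] at this; simp [shift_apply, add_assoc, h1, h2] at this
    · have := congrFun s2 1; rw [s1] at this; simp [shift_apply, add_assoc, h1, h2] at this
  · -- both direction 2
    have hb := hsame (d1.trans d2.symm)
    rcases s1 with s1 | s1 <;> rcases s2 with s2 | s2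
    · exact hb (((r2 d1 hP hQ).1 s1).trans ((r2 d2 hP' hQ').1 s2).symm)
    · have := congrFun s1 1; rw [s2] at this; simp [shift_apply, add_assoc, h1, h2] at this
    · have := congrFun s2 1; rw [s1] at this; simp [shift_apply, add_assoc, h1, h2] at this
    · exact hb (((r2 d1 hP hQ).2 s1).trans ((r2 d2 hP' hQ').2 s2).symm)

/-! ## §3 A plaquette touching both `P₀ = (0; 1,2)` and `P₁ = (e₀; 1,2)` is lateral -/

/-- **Shared with both ⇒ lateral.**  If the plaquette `(y; i, j)`, `i < j`, contains a bond of `P₀ = (0; 1, 2)` and a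
bond of `P₁ = (e₀; 1, 2)`, then it is one of the four lateral plaquettes `(0; 0,1)`, `(e₂; 0,1)`, `(0; 0,2)`, `(e₁; 0,2)`.
(`L ≥ 3`; the proof reads the time coordinate of the shared bonds.) -/
theorem lateral_of_shares_both (hL : 3 ≤ L) (y : Site 4 L) {i j : Fin 4} (hij : i < j) {f f' : Edge 4 L}
    (hf : f ∈ ({((0 : Site 4 L), (1 : Fin 4)), ((0 : Site 4 L).shift 1, (2 : Fin 4)),
      ((0 : Site 4 L).shift 2, (1 : Fin 4)), ((0 : Site 4 L), (2 : Fin 4))} : Finset (Edge 4 L)))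
    (hfq : f ∈ ({(y, i), (y.shift i, j), (y.shift j, i), (y, j)} : Finset (Edge 4 L)))
    (hf' : f' ∈ ({(((0 : Site 4 L).shift 0), (1 : Fin 4)), (((0 : Site 4 L).shift 0).shift 1, (2 : Fin 4)),
      (((0 : Site 4 L).shift 0).shift 2, (1 : Fin 4)), (((0 : Site 4 L).shift 0), (2 : Fin 4))} :
      Finset (Edge 4 L)))
    (hf'q : f' ∈ ({(y, i), (y.shift i, j), (y.shift j, i), (y, j)} : Finset (Edge 4 L))) :
    i = 0 ∧ ((j = 1 ∧ (y = 0 ∨ y = (0 : Site 4 L).shift 2)) ∨ (j = 2 ∧ (y = (0 : Site 4 L).shift 1 ∨ y = 0))) := by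
  have h1 : (1 : ZMod L) ≠ 0 := by haveI : Fact (1 < L) := ⟨by omega⟩; exact one_ne_zero
  have h2 := Literature.MathematicalPhysics.QuantumLattice.zmod_one_add_one_ne_zero_of_three_le hL
  obtain ⟨t0, -, hP⟩ := bondP_cases (0 : Site 4 L) hf; obtain ⟨t1, -, hP'⟩ := bondP_cases ((0 : Site 4 L).shift 0) hf'
  have hQ := bondQ_cases y i j hfq; have hQ' := bondQ_cases y i j hf'q
  simp only [Pi.zero_apply] at t0
  simp only [shift_apply, Pi.zero_apply, if_true, zero_add] at t1
  have hj0 : j ≠ 0 := fun h => by subst h; exact absurd hij (by simp)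
  by_cases hi0 : i = 0
  · subst hi0
    refine ⟨rfl, ?_⟩
    have hdir : f.2 = 1 ∨ f.2 = 2 := by rcases hP with h | h <;> simp [h.1]
    have hdir' : f'.2 = 1 ∨ f'.2 = 2 := by rcases hP' with h | h <;> simp [h.1]
    -- both shared bonds are direction-`j` bonds of `q`
    have hA : ∀ {g : Edge 4 L}, (g.2 = 1 ∨ g.2 = 2) →
        ((g.2 = 0 ∧ (g.1 = y ∨ g.1 = y.shift j)) ∨ (g.2 = j ∧ (g.1 = y.shift 0 ∨ g.1 = y))) →
        g.2 = j ∧ (g.1 = y.shift 0 ∨ g.1 = y) := by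
      intro g hg hgQ
      rcases hgQ with h | h
      · rcases hg with hg | hg <;> simp [hg] at h
      · exact h
    obtain ⟨hd, hs⟩ := hA hdir hQ
    obtain ⟨hd', hs'⟩ := hA hdir' hQ'
    -- time coordinates: `f` at time 0, `f'` at time 1
    have hsy : f.1 = y := by
      rcases hs with hs | hs
      · exfalso
        rw [hs] at t0
        rcases hs' with hs' | hs'
        · rw [hs'] at t1; rw [t0] at t1; exact h1 t1.symm
        · rw [hs'] at t1; simp only [shift_apply, if_true] at t0; rw [t1] at t0; exact h2 t0
      · exact hs
    rw [hsy] at hP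
    rcases hP with ⟨hd1, hs1⟩ | ⟨hd2, hs2⟩
    · left; exact ⟨hd.symm.trans hd1, hs1⟩
    · right; exact ⟨hd.symm.trans hd2, hs2⟩
  · -- `i ≠ 0`: every bond of `q` sits at time `y 0`, which cannot be both `0` and `1`
    exfalso
    have hA : ∀ {g : Edge 4 L},
        ((g.2 = i ∧ (g.1 = y ∨ g.1 = y.shift j)) ∨ (g.2 = j ∧ (g.1 = y.shift i ∨ g.1 = y))) → g.1 0 = y 0 := by
      intro g hgQ
      rcases hgQ with ⟨-, hs | hs⟩ | ⟨-, hs | hs⟩ <;> rw [hs] <;> simp [shift_apply, Ne.symm hi0, Ne.symm hj0]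
    have a := hA hQ
    have a' := hA hQ'
    rw [t0] at a; rw [t1] at a'
    exact h1 (a'.trans a.symm)

/-! ## §4 The surviving short polymers are exactly the four laterals -/

/-- The four bonds of a plaquette in the `(1,2)` plane are distinct (`L ≥ 3`). -/
theorem card_bondP (hL : 3 ≤ L) (x : Site 4 L) :
    ({(x, (1 : Fin 4)), (x.shift 1, (2 : Fin 4)), (x.shift 2, (1 : Fin 4)), (x, (2 : Fin 4))} :
      Finset (Edge 4 L)).card = 4 := by
  have h1 : (1 : ZMod L) ≠ 0 := by haveI : Fact (1 < L) := ⟨by omega⟩; exact one_ne_zero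
  have hx : ∀ k : Fin 4, x.shift k ≠ x := fun k h => by
    have := congrFun h k; simp [shift_apply, h1] at this
  rw [Finset.card_insert_of_notMem, Finset.card_insert_of_notMem, Finset.card_pair]
  · intro h; exact hx 2 (Prod.ext_iff.1 h).1
  · simp only [Finset.mem_insert, Finset.mem_singleton, Prod.mk.injEq, not_or]
    exact ⟨fun h => absurd h.2 (by decide), fun h => hx 1 h.1⟩
  · simp only [Finset.mem_insert, Finset.mem_singleton, Prod.mk.injEq, not_or]
    exact ⟨fun h => absurd h.2 (by decide), fun h => hx 2 h.1.symm, fun h => absurd h.2 (by decide)⟩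

/-- **Covering with at most four plaquettes forces the four laterals.**  Let `Q` be a set of at most four plaquettes of
the 4-torus (`L ≥ 3`) such that every bond of `P₀ = (0; 1,2)` is a bond of some member of `Q` other than `P₀`, and
every bond of `P₁ = (e₀; 1,2)` is a bond of some member of `Q` other than `P₁`.  Then `Q` is the set of the four
lateral plaquettes `(0; 0,1)`, `(e₂; 0,1)`, `(0; 0,2)`, `(e₁; 0,2)`. -/
theorem eq_laterals_of_covering (hL : 3 ≤ L) {Q : Finset (Plaquette 4 L)} (hcard : Q.card ≤ 4)
    (h0 : ∀ e ∈ ({((0 : Site 4 L), (1 : Fin 4)), ((0 : Site 4 L).shift 1, (2 : Fin 4)),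
        ((0 : Site 4 L).shift 2, (1 : Fin 4)), ((0 : Site 4 L), (2 : Fin 4))} : Finset (Edge 4 L)),
      ∃ q ∈ Q, q ≠ ((0 : Site 4 L), ⟨((1 : Fin 4), (2 : Fin 4)), by decide⟩) ∧
        e ∈ ({(q.1, q.2.1.1), (q.1.shift q.2.1.1, q.2.1.2), (q.1.shift q.2.1.2, q.2.1.1), (q.1, q.2.1.2)} :
          Finset (Edge 4 L)))
    (h1 : ∀ e ∈ ({(((0 : Site 4 L).shift 0), (1 : Fin 4)), (((0 : Site 4 L).shift 0).shift 1, (2 : Fin 4)),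
        (((0 : Site 4 L).shift 0).shift 2, (1 : Fin 4)), (((0 : Site 4 L).shift 0), (2 : Fin 4))} :
        Finset (Edge 4 L)),
      ∃ q ∈ Q, q ≠ (((0 : Site 4 L).shift 0), ⟨((1 : Fin 4), (2 : Fin 4)), by decide⟩) ∧
        e ∈ ({(q.1, q.2.1.1), (q.1.shift q.2.1.1, q.2.1.2), (q.1.shift q.2.1.2, q.2.1.1), (q.1, q.2.1.2)} :
          Finset (Edge 4 L))) :
    Q = {((0 : Site 4 L), ⟨((0 : Fin 4), (1 : Fin 4)), by decide⟩),
      ((0 : Site 4 L).shift 2, ⟨((0 : Fin 4), (1 : Fin 4)), by decide⟩),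
      ((0 : Site 4 L), ⟨((0 : Fin 4), (2 : Fin 4)), by decide⟩),
      ((0 : Site 4 L).shift 1, ⟨((0 : Fin 4), (2 : Fin 4)), by decide⟩)} := by
  classical
  -- a plaquette `q ≠ P` read as `¬ (q.1 = x ∧ i = 1 ∧ j = 2)`
  have hne : ∀ {x : Site 4 L} {q : Plaquette 4 L},
      q ≠ (x, ⟨((1 : Fin 4), (2 : Fin 4)), by decide⟩) → ¬ (q.1 = x ∧ q.2.1.1 = 1 ∧ q.2.1.2 = 2) := by
    rintro x ⟨y, ⟨⟨i, j⟩, hij⟩⟩ hq ⟨rfl, hi, hj⟩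
    simp only at hi hj
    subst hi; subst hj
    exact hq rfl
  -- the covering maps `bonds(P₀) → Q`, `bonds(P₁) → Q` are injective (part `bond_unique_of_ne`)
  have step : ∀ (x : Site 4 L),
      (∀ e ∈ ({(x, (1 : Fin 4)), (x.shift 1, (2 : Fin 4)), (x.shift 2, (1 : Fin 4)), (x, (2 : Fin 4))} :
          Finset (Edge 4 L)),
        ∃ q ∈ Q, q ≠ (x, ⟨((1 : Fin 4), (2 : Fin 4)), by decide⟩) ∧
          e ∈ ({(q.1, q.2.1.1), (q.1.shift q.2.1.1, q.2.1.2), (q.1.shift q.2.1.2, q.2.1.1), (q.1, q.2.1.2)} :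
            Finset (Edge 4 L))) →
      4 ≤ Q.card ∧ ∀ q ∈ Q, q ≠ (x, ⟨((1 : Fin 4), (2 : Fin 4)), by decide⟩) ∧
        ∃ e ∈ ({(x, (1 : Fin 4)), (x.shift 1, (2 : Fin 4)), (x.shift 2, (1 : Fin 4)), (x, (2 : Fin 4))} :
          Finset (Edge 4 L)),
          e ∈ ({(q.1, q.2.1.1), (q.1.shift q.2.1.1, q.2.1.2), (q.1.shift q.2.1.2, q.2.1.1), (q.1, q.2.1.2)} :
            Finset (Edge 4 L)) := by
    intro x hx
    set B : Finset (Edge 4 L) :=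
      {(x, (1 : Fin 4)), (x.shift 1, (2 : Fin 4)), (x.shift 2, (1 : Fin 4)), (x, (2 : Fin 4))} with hB
    let f : Edge 4 L → Plaquette 4 L := fun e =>
      if he : e ∈ B then Classical.choose (hx e he) else (x, ⟨((1 : Fin 4), (2 : Fin 4)), by decide⟩)
    have hf : ∀ e (he : e ∈ B), f e ∈ Q ∧ f e ≠ (x, ⟨((1 : Fin 4), (2 : Fin 4)), by decide⟩) ∧
        e ∈ ({((f e).1, (f e).2.1.1), ((f e).1.shift (f e).2.1.1, (f e).2.1.2),
          ((f e).1.shift (f e).2.1.2, (f e).2.1.1), ((f e).1, (f e).2.1.2)} : Finset (Edge 4 L)) := by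
      intro e he
      have hspec := Classical.choose_spec (hx e he)
      simp only [f, dif_pos he]
      exact ⟨hspec.1, hspec.2.1, hspec.2.2⟩
    have hinj : Set.InjOn f B := by
      intro e he e' he' hee'
      have h := hf e he
      have h' := hf e' he'
      rw [← hee'] at h'
      exact bond_unique_of_ne hL x (f e).1 (f e).2.2 (hne h.2.1) he h.2.2 he' h'.2.2
    have hmaps : ∀ e ∈ B, f e ∈ Q := fun e he => (hf e he).1
    have hcardB : B.card = 4 := card_bondP hL x
    have h4 : 4 ≤ Q.card := by have := Finset.card_le_card_of_injOn f hmaps hinj; omega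
    refine ⟨h4, fun q hq => ?_⟩
    obtain ⟨e, he, rfl⟩ := Finset.surj_on_of_inj_on_of_card_le (fun e _ => f e) hmaps
      (fun a b ha hb h => hinj ha hb h) (by omega) q hq
    exact ⟨(hf e he).2.1, e, he, (hf e he).2.2⟩
  obtain ⟨h4, hQ0⟩ := step 0 h0
  obtain ⟨-, hQ1⟩ := step ((0 : Site 4 L).shift 0) h1
  -- every member of `Q` touches both `P₀` and `P₁`, hence is lateral
  have hsub : Q ⊆ {((0 : Site 4 L), ⟨((0 : Fin 4), (1 : Fin 4)), by decide⟩),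
      ((0 : Site 4 L).shift 2, ⟨((0 : Fin 4), (1 : Fin 4)), by decide⟩),
      ((0 : Site 4 L), ⟨((0 : Fin 4), (2 : Fin 4)), by decide⟩),
      ((0 : Site 4 L).shift 1, ⟨((0 : Fin 4), (2 : Fin 4)), by decide⟩)} := by
    rintro ⟨y, ⟨⟨i, j⟩, hij⟩⟩ hq
    obtain ⟨-, e, he, heq⟩ := hQ0 _ hq
    obtain ⟨-, e', he', he'q⟩ := hQ1 _ hq
    have key := lateral_of_shares_both hL y hij he heq he' he'q
    obtain ⟨rfl, hrest⟩ := key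
    simp only [Finset.mem_insert, Finset.mem_singleton]
    rcases hrest with ⟨rfl, rfl | rfl⟩ | ⟨rfl, rfl | rfl⟩ <;> simp
  exact Finset.eq_of_subset_of_card_le hsub (Finset.card_le_four.trans h4)

/-! ## §5 The twelve bonds of the cube -/

/-- **The twelve bonds of the unit cube are distinct** (`L ≥ 3`).  In the order used by the cube integral (part 2):
bottom `a₁ … a₄ = (0,1), (e₁,2), (e₂,1), (0,2)`, top `b₁ … b₄ = (e₀,1), (e₀+e₁,2), (e₀+e₂,1), (e₀,2)`, timelike
`c₀, c₁, c₂, c₁₂ = (0,0), (e₁,0), (e₂,0), (e₁+e₂,0)`. -/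
theorem cubeEdge_injective (hL : 3 ≤ L) :
    Injective (![((0 : Site 4 L), (1 : Fin 4)), ((0 : Site 4 L).shift 1, (2 : Fin 4)),
      ((0 : Site 4 L).shift 2, (1 : Fin 4)), ((0 : Site 4 L), (2 : Fin 4)),
      ((0 : Site 4 L).shift 0, (1 : Fin 4)), (((0 : Site 4 L).shift 0).shift 1, (2 : Fin 4)),
      (((0 : Site 4 L).shift 0).shift 2, (1 : Fin 4)), ((0 : Site 4 L).shift 0, (2 : Fin 4)),
      ((0 : Site 4 L), (0 : Fin 4)), ((0 : Site 4 L).shift 1, (0 : Fin 4)),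
      ((0 : Site 4 L).shift 2, (0 : Fin 4)), (((0 : Site 4 L).shift 1).shift 2, (0 : Fin 4))] :
        Fin 12 → Edge 4 L) := by
  have h1 : (1 : ZMod L) ≠ 0 := by haveI : Fact (1 < L) := ⟨by omega⟩; exact one_ne_zero
  -- an explicit left inverse reading the direction and the coordinates `0, 1, 2`
  refine LeftInverse.injective (g := fun zk : Edge 4 L =>
    if zk.2 = 1 then (if zk.1 0 = 0 then (if zk.1 2 = 0 then 0 else 2) else (if zk.1 2 = 0 then 4 else 6))
    else if zk.2 = 2 then (if zk.1 0 = 0 then (if zk.1 1 = 0 then 3 else 1) else (if zk.1 1 = 0 then 7 else 5))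
    else (if zk.1 1 = 0 then (if zk.1 2 = 0 then 8 else 10) else (if zk.1 2 = 0 then 9 else 11))) ?_
  intro k
  fin_cases k <;> simp [shift_apply, h1]

end Summit.QuantumFields.YangMills.Cruxes.IR.SCFloor
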